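import Mathlib
import HarnessLib
import HarnessLib.Audit
import Summits.HodgeConjecture.Statement
import Literature.AlgebraicGeometry.Motives.BettiRealization
import Literature.AlgebraicGeometry.Motives.Lefschetz
import Literature.AlgebraicGeometry.Motives.SummitCompatible
import HarnessLib.Audit.Status.Attr

/-!
Route: MomentAmplification

DORMANT since 2026-08-27T04:04:18Z (reconciler: no traction for 5 d (last activity item-evidence-added at 2026-08-22T02:31:09Z); parked, not closed — `ledger route dormant route-HodgeConjecture-MomentAmplification --off` to reactivate) — unstaffed, not closed; items shared with open routes are served there. `ledger route dormant <id> --off` reactivates.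

Route MomentAmplification — "Hodge = motivated is a counting statement on powers" (idea card
amplification-moment-criterion); rev 4 = cone repair (all ten undischarged cone facts routed around,
statements re-based on the clean-cone guard `BettiHodgeData.IsComparisonCompatible`).

THESIS X (words). It suffices to show, for every comparison-compatible Betti–Hodge realization B
(Motives/SummitCompatible.lean: B-Hodge classes = rational (p,p)-classes of H^{2p}(X(ℂ);ℂ) under the
complexified comparison, complexified B-algebraic classes span N^p H^{2p} =
HodgeTheory.algebraicClasses, Hodge models exist) — the classical one exists (BettiCompat, a
construction) — that
 (Density) for every smooth projective X/ℂ of dimension n the ALGEBRAIC classes of codimension nN on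
the power X^{2N} fill MORE THAN HALF of the Hodge classes there for infinitely many N: ∃ δ > 0,
frequently in N, m_N(X) := dim_ℚ ℚ·A^{nN}(X^{2N}) ≥ (1/2 + δ) · h_N(X), h_N(X) := dim_ℚ
Hdg^{nN}(X^{2N}) (crux AlgebraicDensity);
 (B) Grothendieck's standard conjecture of Lefschetz type, θ-form, for B.W (crux LefschetzBetti, =
`B.W.LefschetzStandardConjecture` unfolded).
Since B ⇒ A_mot = A (André 1996 Thm 0.4), Density ∧ B is the same X as before (motivated density ∧
B); counting algebraic instead of motivated classes only moves the B-dependence between the two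
cruxes and frees the route from Motives/Correspondences + MotivatedCycles + RationalLattice, whose
module cones carry the open standard-conjecture defs and undischarged André/flat-pull-back facts.

MECHANISM (why X → HodgeConjecture). h_N(X) = dim End_{MT}(H^{⊗N}) and, under B, m_N(X) = dim
End_{G_mot}(H^{⊗N}) for H = H^*(X,ℚ) (Künneth + Poincaré duality H^∨ ≅ H(n); MT = Mumford–Tate group
of the total cohomology, connected reductive; G_mot ⊇ MT André's motivated Galois group, reductive,
fixing exactly the motivated = algebraic tensors [Andre1996Motifs §4.6, Thm 0.4]) — support
TannakaBridge delivers these as ABSTRACT subgroups M ≤ G ≤ GL_d(ℂ) with the two counts. Both counts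
are 2N-th MOMENTS ∫_K |χ_H|^{2N} over compact forms, and Laplace asymptotics (no non-trivial
scalars: both groups fix 1 ∈ H^0) give the HALF-OR-ALL dichotomy (support HalfOrAll): m_N = h_N for
all N, or eventually m_N ≤ (1/2+δ) h_N for every δ > 0 (ratio → 1/[Ḡ:Ḡ⁰] ≤ 1/2 or O(N^{-1/2})).
Density excludes the second alternative because h_N ≥ 1 (support DensityForcesEquality, provable
now), so the invariants of M and G agree on every T^{N,N}, hence on every mixed tensor space (a
fixed vector and covector pad a,b up to N,N), hence M̄ = Ḡ (Deligne LNM 900 I 3.1(c)) and every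
Hodge class of X is motivated, i.e. algebraic by B (TannakaBridge's rigidity clause gives
B.HodgeConjectureFor); comparison-compatibility transports B.HodgeConjectureFor to
HodgeTheory.HodgeConjectureFor (tree theorem IsComparisonCompatible.hodgeConjectureFor).

X (Lean). X = AlgebraicDensity ∧ LefschetzBetti (cruxes), with support HalfOrAll, BettiCompat,
TannakaBridge, DensityForcesEquality; no separate Target decl.
Lean: `AlgebraicDensity ∧ LefschetzBetti` — deciding theorem `closes : AlgebraicDensity →
LefschetzBetti → HalfOrAll → BettiCompat → TannakaBridge → DensityForcesEquality → HodgeConjecture`,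
PROVED (planner's Sketch.lean rc 0, 0 sorry, 12 lines of logic + two rewrites; native audit: closes
OK, conclusion HodgeConjecture, hypotheses = the six items, axioms propext/choice/Quot.sound; route
deps: 141 project constants, none unproved except the summit statement itself). Constants (lean
check rc 0): Literature.AlgebraicGeometry.Motives.{BettiHodgeData,
.hodge/.W/.IsComparisonCompatible/.HodgeConjectureFor, HodgeStructure.hodgeClasses,
IsSmoothProjective, SchemeOver,
PreWeilCohomology.algebraicClasses/IsHyperplaneClass/IsLefschetzTheta/IsAlgebraicOperator}, Mathlib
TensorProduct/TensorPower/PiTensorProduct.map/LinearMap.eqLocus/Subgroup.relIndex/Module.finrank/Filter.atTop,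
root `HodgeConjecture`. Imports: BettiRealization, Lefschetz, SummitCompatible (64-module Literature
cone, 137 closed named facts, all discharged).

Rationale: WHY THIS LINE. André reduced HC to (Hodge ⇒ motivated) + B [Andre1996Motifs Thm 0.4, §4.6, 0.6.2].
The first conjunct is a qualitative inclusion usually attacked by CLASSIFYING Mumford–Tate groups
and their invariants (FFT). Import from representation theory / ℓ-adic monodromy: Larsen–Pink
dimension data and Katz's moments [LarsenPink1990, Katz2004LarsenAlternative] with the Gaussian
(CLT) scaling of tensor-power multiplicities [Biane1993TensorMultiplicities, TateZelditch2004,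
CoquereauxZuber2011]. Only the GROWTH of dim End_K(H^{⊗N}) ~ c_K h^{2N} N^{-dim K/2} is used, so
"Hodge = algebraic on all powers of X" becomes: algebraic classes have density > 1/2 among the Hodge
classes of the middle degree of X^{2N}, frequently in N — a COUNT (rank of an intersection Gram
matrix against the Weyl-integral value of h_N) that never names which Hodge classes are hit. The
threshold 1/2 is sharp and unconditional; the card's 1/√N threshold needs connectedness of G_mot
over ℂ, which André states he cannot prove [Andre1996Motifs p.25] — deliberately NOT used.
Formalisation choices (rev 4, cone repair): B-parametrised items are GUARDED by
`B.IsComparisonCompatible` (Motives/SummitCompatible.lean — the cohomology-level twin of the cocycle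
guard; an unguarded B can declare all even cohomology (p,p) and refute any count, cf. the
route-review objection that blocked the old Amplification); algebraic classes of B.W are counted
instead of motivated ones (equivalent under crux B; motivated classes and
`LefschetzStandardConjecture` live in modules whose cones carry the open standard-conjecture defs,
so B is UNFOLDED to its θ-form); the Tannakian inputs (MT, G_mot) enter only as abstract subgroups
of GL_d(ℂ) with matching invariant counts and a rigidity clause, delivered under B by the support
item TannakaBridge; the numerical step is isolated as DensityForcesEquality (provable now,
guard-free). Imports: BettiRealization, Lefschetz, SummitCompatible only.

RANKED CRUXES.
#2 AlgebraicDensity — the bet: ∀ compatible B, ∀ X, algebraic density > 1/2 frequently (why it might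
fail: joined with B it is HC on all powers of X, harder than the motivated form in the abelian range
— type III/IV beyond Markman; even-orthogonal MT: known supply has density exactly 1/2; sources
Andre1996Motifs, Deligne1982HodgeCycles, Markman2025SecantWeil, vanGeemen1994HodgeAV,
LarsenPink1990). Test beds for tenure (not filed): Weil-type abelian 2n-folds (divisors + Markman's
Weil classes: density 1?), symplectic / odd-orthogonal big monodromy (FFT: ψ, ψ⁻¹ algebraic under
B), even-orthogonal big monodromy (determinant class), Fermat hypersurfaces (both sides character
sums — kit-computable).
#3 LefschetzBetti — B(X) in θ-form for B.W of every compatible B (why: open since 1968 beyond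
curves, surfaces, abelian varieties, complete intersections, flag varieties; sources
Grothendieck1968, Kleiman1968, Lieberman1968). Shared node with every motivated/absolute-Hodge line.
SUPPORT. HalfOrAll (kept verbatim; provable now: unitarian trick, Haar projector, Laplace) ·
BettiCompat (∃ B compatible: construction of the classical realization) · TannakaBridge (∀
compatible B with B: abstract M ≤ G with RED/CONN/FIX, the two counts, smooth-projectivity of the
powers, and rigidity 'equal invariants on all T^{N,N} ⇒ B.HodgeConjectureFor' — André §4.6 + Thm
0.4, Deligne LNM 900 I 3.1(c)/3.4/3.6) · DensityForcesEquality (dichotomy + density ⇒ m_N = h_N,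
provable now from the C-lite axioms: h_N ≥ 1).

KILL CRITERIA. (i) A compatible-B computation of a family with density limit in (1/2, 1) or a
non-convergent ratio refutes HalfOrAll's use (and would contradict reductivity — check the statement
first). (ii) An X with m_N/h_N → 1/d, d ≥ 2 PROVED (a phantom Artin motive over ℂ, or algebraic ≠
motivated on powers) kills Density but is itself a major theorem. (iii) If BettiCompat is refuted
because singular cohomology cannot instantiate the C-lite axioms / BettiHodgeData fields literally,
the ∀B-items go vacuous: re-base on corrected realization data, do not celebrate. (iv) If every
density lower bound provably needs the full stabiliser/FFT of MT (the relocation objection made a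
theorem), close as reformulation and bank HalfOrAll + DensityForcesEquality as Literature lemmas.
(v) TannakaBridge refuted-as-stated (abstract RED/CONN/FIX not met by MT(ℂ)/G_mot(ℂ)) ⇒ restate the
package, not the line.

NOT DECOMPOSED YET. No per-family FactoryExponent items; no √N/connectedness variant (separate
conditional route if wanted); TannakaBridge is the first candidate for a glued split ((groups +
counts) | rigidity | powers) once a prover sizes it; no Literature notions for X^{k}, invariant
ranks (the not-imported MotivatedGaloisGroupCounts.lean has them but its cone carries
MotivatedCycles — a librarian could move `schemePow`/RED/CONN/FIX/INV to a fact-free module, after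
which signatures shorten by set-signature). CONE HYGIENE for provers: Theorems files may import
Motives/Correspondences or MotivatedCycles (e.g. `show B.W.LefschetzStandardConjecture`), the ROUTE
must not.

CHEAPEST FALSIFIER. Finite-group sanity of HalfOrAll (d ≤ 3, M ≤ G ≤ GL_d finite: RED/CONN/FIX force
the dichotomy — passed on paper by the route review) and the first non-abelian-type count: a general
cubic fourfold or a K3-type X where MT = SO-type and the known algebraic supply on X^{2N} (graphs of
correspondences, Chern classes of Fourier–Mukai kernels) is a tensor-invariant factory — if its Gram
rank is provably ≤ (1/2)·h_N for all large N with no further supply in sight, the bet is dead in its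
first test bed (kill criterion iv).

Novelty: NOVELTY (search-before-claim; card graded new-combination by refuter-novelty-audit-7-0, confirmed at
open; unchanged by the rev-4 cone repair, which re-bases the same statements on the clean-cone guard
and counts algebraic instead of motivated classes — equivalent under crux B). Nearest prior art
FOUND: (A) moments/dimension data — LarsenPink1990 (doi:10.1007/bf01233432: invariant dimensions
determine a connected semisimple subgroup up to finitely many possibilities),
Katz2004LarsenAlternative (M_4 and big monodromy), CLT asymptotics of tensor-power multiplicities
Biane1993TensorMultiplicities / TateZelditch2004 (doi:10.1016/j.jfa.2004.01.004) /
CoquereauxZuber2011 (doi:10.1088/1751-8113/44/29/295208): dim End_K(V^{⊗N}) ~ c v^{2N} N^{-dim K/2};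
(B) the Tannakian criterion — Deligne1982HodgeCycles I Prop 3.1 (read: book pp.33–34),
Andre1996Motifs §4.6 (i)(ii) and Remarque p.25 (read: motivated Galois group reductive, fixes
exactly the motivated mixed tensors; connectedness over ℂ unknown), DeligneMilne1982 II 6.22–6.23
(read: book pp.153–154). DELTA: the joined statement "algebraic (equivalently, under B, motivated)
classes of density > 1/2 in the middle cohomology of X^{2N}, frequently in N, force Hdg = A on all
powers of X" — a half-or-all amplification for the Hodge conjecture — was found nowhere (searches at
open: lit search --hybrid 'André motivated cycles', lit vsearch 'motivic Galois group contains
Mumford–Tate, equality iff Hodge classes motivated' (GGK, LNM 900, Carls  [refs: 10.1007/bf01233432:, 10.1016/j.jfa.2004.01.004, 10.1088/1751-8113/44/29/295208, 2603.20268, 2603.22171, doi:10.1007/bf01233432, doi:10.1016/j.jfa.2004.01.004, doi:10.1088/1751-8113/44/29/295208, LarsenPink1990, TateZelditch2004, CoquereauxZuber2011, DeligneMilne1982]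

Barriers (technique_class: mumford-tate-groups, invariant-theory, motivated, conj-B): - technique_class: mumford-tate-groups, invariant-theory, motivated, conj-B (moment asymptotics of
tensor invariants; catalogue Literature/Barriers/HodgeConjecture scanned by decl)
- Literature.Barriers.HodgeConjecture.Weil1977_exceptionalHodgeClasses: consistent and QUANTIFIED —
on a general Weil-type 2n-fold the classes generated by End and the polarisation are the invariants
of GU_K(W,φ), of dimension dim MT + 1, so their density among Hodge classes of A^{2N} is O(N^{-1/2})
(third case of the trichotomy: one generator — the Weil class — short); the route never claims
divisor-generated classes suffice, it counts ALL algebraic classes (Markman2025SecantWeil supplies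
the Weil classes of Weil-type abelian 2n-folds) and, under crux B, all motivated ones (⋆, Λ).
- Literature.Barriers.HodgeConjecture.Mumford1968_simpleFourfold_exceptionalHodgeClasses: same
evasion; simplicity plays no role in a count on powers.
- Literature.Barriers.HodgeConjecture.Andre1996_hodgeClassesOnAbelianVarieties_motivated: for
abelian varieties MOTIVATED density is 1 (André 0.6.2) and B is known (Lieberman), so there the pair
(AlgebraicDensity, LefschetzBetti) reduces to HC for abelian varieties itself — the route has
content only beyond the abelian-type range or through new algebraic supply (stated openly; kill
criterion iv).
- Literature.Barriers.HodgeConjecture.Grothendieck1969_generalHodgeConjecture_false: no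
coniveau/level statement is made; only (p,p)-classes in degree 2p.
- Literature.Barriers.Ho

History (route lifecycle, newest last):
- 2026-08-15T16:35:40Z · rev 4: restated Assembly (stmt-HodgeConjecture-2805) — cone repair (rrepair g2): re-route around all 10 undischarged cone facts — imports MotivatedCycles+RationalLattice dropped (=> Correspondences' 6 open standard- (planner-rrepair-HodgeConjecture-MomentAmplific-1838a883-g2-0)
- 2026-08-15T16:35:40Z · rev 4: dropped MotivatedDensity, LefschetzB, BettiBridge, Amplification — cone repair (rrepair g2): re-route around all 10 undischarged cone facts — imports MotivatedCycles+RationalLattice dropped (=> Correspondences' 6 open standard- (planner-rrepair-HodgeConjecture-MomentAmplific-1838a883-g2-0)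
- 2026-08-27T04:04:18Z · DORMANT — reconciler: no traction for 5 d (last activity item-evidence-added at 2026-08-22T02:31:09Z); parked, not closed — `ledger route dormant route-HodgeConjecture-Mo (operator:999:1302851)

sub-problem: HodgeConjecture · status: dormant · opened planner-plancard-HodgeConjecture-HodgeConject-84a2ac70-0 2026-08-15T11:08:25Z · rev 5 · ledger route-HodgeConjecture-MomentAmplification
GENERATED by the gate from the ledger (D-0016/17). Provers cite these decls: `theorem foo : Summit.HodgeConjecture.HodgeConjecture.Theses.MomentAmplification.<Decl> := …` in Summits/HodgeConjecture/HodgeConjecture/Theorems/<Name>.lean.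
-/

namespace Summit.HodgeConjecture.HodgeConjecture.Theses.MomentAmplification

open scoped BigOperators Topology Manifold Classical MeasureTheory ProbabilityTheory Matrix InnerProductSpace ComplexConjugate ContinuousMap
open Filter Set Function TopologicalSpace MeasureTheory

attribute [summit_statement] _root_.HodgeConjecture

/-- item stmt-HodgeConjecture-11035 · crux · rank 2 · open · by planner
why it might fail: Joined with B it is HC on all powers of X: open beyond the abelian-type range and harder than the motivated form there (simple abelian varieties of type III/IV outside Markman's Weil-type results); even-orthogonal MT (surfaces, p_g ≥ 2): known supply has density exactly 1/2 (determinant class).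
sources: Andre1996Motifs, Deligne1982HodgeCycles, Markman2025SecantWeil, vanGeemen1994HodgeAV, LarsenPink1990, arXiv:2603.20268
[crux] THE BET (card amplification-moment-criterion), now counted with ALGEBRAIC classes: for every
comparison-compatible Betti–Hodge realization B (`B.IsComparisonCompatible`,
Motives/SummitCompatible.lean: (a) B-Hodge classes = classes whose complexified comparison is of
Hodge type (p,p), (b) complexified B-algebraic classes span N^p H^{2p}(X(ℂ);ℂ), (c) Hodge models
exist) and every smooth projective X/ℂ of dimension n there is δ > 0 such that for infinitely many N
(with a smooth-projectivity witness of X^{2N} := Nat.rec 𝟙 (· ⊗ X) (2N), dimension 2Nn) (1/2 + δ) ·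
dim_ℚ Hdg^{nN}_B(X^{2N}) ≤ dim_ℚ ℚ·A^{nN}_B(X^{2N}) (B.W.algebraicClasses; full middle cohomology,
no Künneth components). Compatibility makes both counts the true ones (rational descent
`linearIndependent_toComplexBetti_iff` + (a),(b)), so for the classical B this is a property of X. A
lower bound is the RANK of an intersection Gram matrix of explicit cycles (graphs, partial
diagonals, Hecke/isogeny correspondences, Chern classes of Fourier–Mukai kernels, automorphism
translates, Markman's Weil classes), h_N is the Weyl integral ∫_{MT_c}|χ_H|^{2N}. With HalfOrAll +
TannakaBridge + LefschetzBetti it is equivalent to 'm_N -/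
@[route_item "route-HodgeConjecture-MomentAmplification", crux]
def AlgebraicDensity : Prop :=
  ∀ B : Literature.AlgebraicGeometry.Motives.BettiHodgeData ℂ, B.IsComparisonCompatible → ∀ ⦃n : ℕ⦄ ⦃X : Literature.AlgebraicGeometry.Motives.SchemeOver ℂ⦄, Literature.AlgebraicGeometry.Motives.IsSmoothProjective n X → (let pow := (fun k : ℕ => @Nat.rec (fun _ => Literature.AlgebraicGeometry.Motives.SchemeOver ℂ) (CategoryTheory.MonoidalCategoryStruct.tensorUnit (Literature.AlgebraicGeometry.Motives.SchemeOver ℂ)) (fun _ Y => CategoryTheory.MonoidalCategoryStruct.tensorObj Y X) k); (∃ δ : ℝ, 0 < δ ∧ ∃ᶠ N in Filter.atTop, ∃ hN : Literature.AlgebraicGeometry.Motives.IsSmoothProjective (2 * N * n) (pow (2 * N)), (1 / 2 + δ) * ((Module.finrank ℚ ↥((B.hodge hN (2 * (N * n))).hodgeClasses ((N * n : ℕ) : ℤ))) : ℝ) ≤ ((Module.finrank ℚ ↥(B.W.algebraicClasses (pow (2 * N)) (N * n))) : ℝ)))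

/-- item stmt-HodgeConjecture-11036 · crux · rank 3 · open · by planner
why it might fail: Grothendieck's B(X): open since 1968 beyond curves, surfaces, abelian varieties, complete intersections, flag varieties; the θ-form over every IsHyperplaneClass η of a compatible B.W also forces algebraic Künneth projectors (B ⇒ C); no approach for a general fourfold.
sources: Grothendieck1968, Kleiman1968, Lieberman1968, Andre1996Motifs
[crux] Grothendieck's standard conjecture of Lefschetz type B, θ-form, for the Weil cohomology B.W
of every comparison-compatible Betti–Hodge realization B: for X smooth projective of dimension n,
every hyperplane class η (PreWeilCohomology.IsHyperplaneClass: pull-back of an effective divisor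
class of ℙ^N along a closed immersion) and i + r = n there is θ : H^{i+2r}(X) → H^i(X), two-sided
inverse of L^r (IsLefschetzTheta), induced by an algebraic correspondence with ℚ-coefficients
(IsAlgebraicOperator). This is `B.W.LefschetzStandardConjecture` UNFOLDED definitionally
(Correspondences.lean: LefschetzStandardConjecture / StandardConjectureB), so that the route no
longer imports Motives/Correspondences (its six standard-conjecture defs are open conjectures
counted in the module cone); a prover may `show B.W.LefschetzStandardConjecture` in a Theorems file.
The guard pins cup products (iso_cup), pull-backs (naturality of iso), algebraic classes (compat (b)
+ rational descent, at X and at X ⊗ X) and hyperplane classes (non-zero rational multiples of true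
hyperplane classes, by trace_pow_of_isHyperplaneClass), so for the classical realization this is
exactly B(X)/ℂ for all X (θ-form incl -/
@[route_item "route-HodgeConjecture-MomentAmplification", crux]
def LefschetzBetti : Prop :=
  ∀ B : Literature.AlgebraicGeometry.Motives.BettiHodgeData ℂ, B.IsComparisonCompatible → ∀ ⦃n : ℕ⦄ ⦃X : Literature.AlgebraicGeometry.Motives.SchemeOver ℂ⦄, Literature.AlgebraicGeometry.Motives.IsSmoothProjective n X → ∀ η : B.W.obj X 2, B.W.IsHyperplaneClass X η → ∀ (i r j : ℕ), i + r = n → ∀ h₂ : i + 2 * r = j, ∃ θ : B.W.obj X j →ₗ[ℚ] B.W.obj X i, B.W.IsLefschetzTheta n η r h₂ θ ∧ B.W.IsAlgebraicOperator n n θ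

/-- item stmt-HodgeConjecture-2802 · support · rank 4 · open · by planner
why it might fail: True in substance, but stated for ABSTRACT subgroups: RED/CONN/FIX must imply 'closure reductive, connected, scalar-free' exactly as used; a mis-specified hypothesis (complements of ℂ-subspaces of T^{a,b}; relIndex ≠ 0 as finite index) would make it false as stated — cheap to test on finite groups.
sources: LarsenPink1990, Katz2004LarsenAlternative, Biane1993TensorMultiplicities, TateZelditch2004, CoquereauxZuber2011, Deligne1982HodgeCycles
HALF-OR-ALL DICHOTOMY (pure representation theory; the card's Moment Lemma + Amplification, provable
now). For d ∈ ℕ and abstract subgroups M ≤ G of GL_d(ℂ) = ((Fin d → ℂ) ≃ₗ[ℂ] (Fin d → ℂ)) such that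
(RED, stated once for K ∈ {M, G}) M and G act completely reducibly on every mixed tensor space
T^{a,b} = (ℂ^d)^{⊗a} ⊗ ((ℂ^d)^∨)^{⊗b} (every stable subspace has a stable complement), (CONN) every
finite-index subgroup M' ≤ M fixes exactly the tensors M fixes, and (FIX) G fixes a non-zero vector
u₀, put INV_K(N) := dim_ℂ of the K-fixed subspace of T^{N,N} = End((ℂ^d)^{⊗N}) (the action `act a b
g` = g^{⊗a} ⊗ ((g⁻¹)^∨)^{⊗b} is let-bound in the statement). Then EITHER INV_G(N) = INV_M(N) for all
N, OR for every δ > 0 eventually INV_G(N) ≤ (1/2 + δ)·INV_M(N). Proof sketch: pass to Zariski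
closures M̄ ⊆ Ḡ (same invariants); RED ⇒ linearly reductive; CONN + Deligne LNM 900 I Prop 3.1(c) ⇒
M̄ connected; FIX ⇒ no non-trivial scalars in Ḡ; unitarian trick: INV_K(N) = ∫_{K_c} |χ(k)|^{2N} dk
over a maximal compact K_c (Haar projector, tr ∫ρ = dim of invariants); |χ| = d only at k = 1,
|χ(e^X)|² = d²(1 − Var spec X) + O(|X|⁴) non-degenerate, Laplace: INV_K(N) = c_K d^{2N} N^{-dim
K/2}(1+o(1)) on th -/
@[route_item "route-HodgeConjecture-MomentAmplification", crux]
def HalfOrAll : Prop :=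
  ∀ (d : ℕ) (M G : Subgroup ((Fin d → ℂ) ≃ₗ[ℂ] (Fin d → ℂ))), (let act := (fun (a b : ℕ) (g : (Fin d → ℂ) ≃ₗ[ℂ] (Fin d → ℂ)) => TensorProduct.map (PiTensorProduct.map fun _ : Fin a => (g : (Fin d → ℂ) →ₗ[ℂ] (Fin d → ℂ))) (PiTensorProduct.map fun _ : Fin b => (g.symm.dualMap : Module.Dual ℂ (Fin d → ℂ) →ₗ[ℂ] Module.Dual ℂ (Fin d → ℂ)))); M ≤ G → (∀ K : Subgroup ((Fin d → ℂ) ≃ₗ[ℂ] (Fin d → ℂ)), K = M ∨ K = G → ∀ (a b : ℕ) (W : Submodule ℂ (TensorProduct ℂ (TensorPower ℂ a (Fin d → ℂ)) (TensorPower ℂ b (Module.Dual ℂ (Fin d → ℂ))))), (∀ g ∈ K, W ≤ W.comap (act a b g)) → ∃ W' : Submodule ℂ (TensorProduct ℂ (TensorPower ℂ a (Fin d → ℂ)) (TensorPower ℂ b (Module.Dual ℂ (Fin d → ℂ)))), (∀ g ∈ K, W' ≤ W'.comap (act a b g)) ∧ IsCompl W W') → (∀ M' : Subgroup ((Fin d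 → ℂ) ≃ₗ[ℂ] (Fin d → ℂ)), M' ≤ M → M'.relIndex M ≠ 0 → ∀ (a b : ℕ) (t : (TensorProduct ℂ (TensorPower ℂ a (Fin d → ℂ)) (TensorPower ℂ b (Module.Dual ℂ (Fin d → ℂ))))), (∀ g ∈ M', act a b g t = t) → ∀ g ∈ M, act a b g t = t) → (∃ u₀ : (Fin d → ℂ), u₀ ≠ 0 ∧ ∀ g ∈ G, g u₀ = u₀) → ((∀ N : ℕ, (Module.finrank ℂ ↥(⨅ g ∈ G, LinearMap.eqLocus (act N N g) LinearMap.id)) = (Module.finrank ℂ ↥(⨅ g ∈ M, LinearMap.eqLocus (act N N g) LinearMap.id))) ∨ (∀ δ : ℝ, 0 < δ → ∀ᶠ N in Filter.atTop, ((Module.finrank ℂ ↥(⨅ g ∈ G, LinearMap.eqLocus (act N N g) LinearMap.id)) : ℝ) ≤ (1 / 2 + δ) * ((Module.finrank ℂ ↥(⨅ g ∈ M, LinearMap.eqLocus (act N N g) LinearMap.id)) : ℝ))))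

/-- item stmt-HodgeConjecture-11037 · support · rank 9 · open · by planner
why it might fail: A construction, but it fails AS STATED if H^*(X(ℂ);ℚ) cannot instantiate the C-lite WeilCohomology/BettiHodgeData fields literally (cup_comm sign (ij).negOnePow, trace normalisations, IsHyperplaneClass, untwisted polarisation convention).
sources: VoisinHodgeI2002, Kleiman1968, Deligne2000, Fulton1998, SerreGAGA1956
[support] CONSTRUCTION of the classical realization (interface + construction pattern: the ∀B-items
are guarded, nothing is smuggled): there is B : BettiHodgeData ℂ with B.IsComparisonCompatible
(Motives/SummitCompatible.lean:240) — singular cohomology of X(ℂ) with ℚ-coefficients as a C-lite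
Weil cohomology (trace, cycle classes, Künneth, Poincaré duality: VoisinHodgeI2002 Ch. 6–7 and
§11.3; Kleiman1968 §1.2 Ex. (1)), natural iso to bettiFunctor compatible with cup and unit, the
functorial polarizable Hodge structures of Hodge–Deligne, cycle classes of type (p,p) (Voisin I
Prop. 11.20), and (a) B-Hodge classes = classes whose complexified comparison `toComplexBetti` is
IsOfHodgeType p p (Deligne2000 §1), (b) complexified B-algebraic classes span
HodgeTheory.algebraicClasses = N^p H^{2p} (Fulton1998 §19.1), (c) Nonempty (HodgeModel n X)
(SerreGAGA1956 §2 + Hodge decomposition). Clause (1) of the superseded BettiBridge; its Tannakian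
clause moved to TannakaBridge; HasProdHyperplaneClasses and motivated ≤ Hodge are no longer needed.
Not in tree as an instance (lean search ': BettiHodgeData ℂ' → only hypothesis structures). [deps:
none] [difficulty: XL] -/
@[route_item "route-HodgeConjecture-MomentAmplification", crux]
def BettiCompat : Prop :=
  ∃ B : Literature.AlgebraicGeometry.Motives.BettiHodgeData ℂ, B.IsComparisonCompatible

/-- item stmt-HodgeConjecture-11038 · support · rank 9 · open · by planner
why it might fail: Known in print, but fails AS STATED if MT(ℂ)/G_mot(ℂ) miss RED/CONN/FIX exactly as phrased for abstract subgroups, or if the count identities need Künneth / Poincaré duality as isomorphisms of HODGE structures beyond what compat (a) transports from the summit side.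
sources: Andre1996Motifs, Deligne1982HodgeCycles, DeligneMilne1982, Jannsen1992, Kleiman1968, Moonen2004MT
[support] TANNAKIAN PACKAGE under B (known results: Andre1996Motifs §4.6 (i)(ii) p. 24, p. 31, Thm
0.4; Deligne1982HodgeCycles I Prop. 3.1(c), 3.4, 3.6; Jannsen1992): for every comparison-compatible
B whose B.W satisfies B(X) in θ-form for all X (LefschetzBetti's conclusion, inlined) and every
smooth projective X of dimension n there are d and ABSTRACT subgroups M ≤ G ≤ GL_d(ℂ) — intended H =
H^*(X(ℂ),ℚ) total cohomology, d = dim H, M = MT(H)(ℂ), G = G_mot(h(X))(ℂ) — with (RED) M, G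
completely reducible on every mixed tensor space T^{a,b} = (ℂ^d)^{⊗a} ⊗ ((ℂ^d)^∨)^{⊗b}, (CONN)
finite-index subgroups of M fix what M fixes, (FIX) G fixes a non-zero vector (unit of H^0),
(COUNTS) for all N and every smooth-projectivity witness of X^{2N}: dim_ℂ (T^{N,N})^M = dim_ℚ
Hdg^{nN}_B(X^{2N}) and dim_ℂ (T^{N,N})^G = dim_ℚ ℚ·A^{nN}_B(X^{2N}) (MT fixes exactly the weight-0
Hodge tensors, G_mot exactly the motivated ones, = algebraic under B; Poincaré duality H^∨ ≅ H(n)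
and Künneth turn T^{N,N} into H^{2nN}(X^{2N}); compat makes B-counts the true counts), (POW) every
X^{2N} := Nat.rec 𝟙 (· ⊗ X) (2N) is smooth projective of dimension 2Nn
(IsSmoothProjective.tensor_holds, isSmoothProjective_unit_holds -/
@[route_item "route-HodgeConjecture-MomentAmplification", crux]
def TannakaBridge : Prop :=
  ∀ B : Literature.AlgebraicGeometry.Motives.BettiHodgeData ℂ, B.IsComparisonCompatible → (∀ ⦃n : ℕ⦄ ⦃X : Literature.AlgebraicGeometry.Motives.SchemeOver ℂ⦄, Literature.AlgebraicGeometry.Motives.IsSmoothProjective n X → ∀ η : B.W.obj X 2, B.W.IsHyperplaneClass X η → ∀ (i r j : ℕ), i + r = n → ∀ h₂ : i + 2 * r = j, ∃ θ : B.W.obj X j →ₗ[ℚ] B.W.obj X i, B.W.IsLefschetzTheta n η r h₂ θ ∧ B.W.IsAlgebraicOperator n n θ) → ∀ ⦃n : ℕ⦄ ⦃X : Literature.AlgebraicGeometry.Motives.SchemeOver ℂ⦄ (hX : Literature.AlgebraicGeometry.Motives.IsSmoothProjective n X), (let pow := (fun k : ℕ => @Nat.rec (fun _ => Literature.AlgebraicGeometry.Motives.SchemeOver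 ℂ) (CategoryTheory.MonoidalCategoryStruct.tensorUnit (Literature.AlgebraicGeometry.Motives.SchemeOver ℂ)) (fun _ Y => CategoryTheory.MonoidalCategoryStruct.tensorObj Y X) k); (∃ (d : ℕ) (M G : Subgroup ((Fin d → ℂ) ≃ₗ[ℂ] (Fin d → ℂ))), (let act := (fun (a b : ℕ) (g : (Fin d → ℂ) ≃ₗ[ℂ] (Fin d → ℂ)) => TensorProduct.map (PiTensorProduct.map fun _ : Fin a => (g : (Fin d → ℂ) →ₗ[ℂ] (Fin d → ℂ))) (PiTensorProduct.map fun _ : Fin b => (g.symm.dualMap : Module.Dual ℂ (Fin d → ℂ) →ₗ[ℂ] Module.Dual ℂ (Fin d → ℂ)))); M ≤ G ∧ (∀ K : Subgroup ((Fin d → ℂ) ≃ₗ[ℂ] (Fin d → ℂ)), K = M ∨ K = G → ∀ (a b : ℕ) (W : Submodule ℂ (TensorProduct ℂ (TensorPower ℂ a (Fin d → ℂ)) (TensorPower ℂ b (Module.Dual ℂ (Fin d → ℂ))))), (∀ g ∈ K, W ≤ W.comap (act a b g)) → ∃ W' : Submodule ℂ (TensorProduct ℂ (TensorPower ℂ a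 (Fin d → ℂ)) (TensorPower ℂ b (Module.Dual ℂ (Fin d → ℂ)))), (∀ g ∈ K, W' ≤ W'.comap (act a b g)) ∧ IsCompl W W') ∧ (∀ M' : Subgroup ((Fin d → ℂ) ≃ₗ[ℂ] (Fin d → ℂ)), M' ≤ M → M'.relIndex M ≠ 0 → ∀ (a b : ℕ) (t : (TensorProduct ℂ (TensorPower ℂ a (Fin d → ℂ)) (TensorPower ℂ b (Module.Dual ℂ (Fin d → ℂ))))), (∀ g ∈ M', act a b g t = t) → ∀ g ∈ M, act a b g t = t) ∧ (∃ u₀ : (Fin d → ℂ), u₀ ≠ 0 ∧ ∀ g ∈ G, g u₀ = u₀) ∧ (∀ (N : ℕ) (hN : Literature.AlgebraicGeometry.Motives.IsSmoothProjective (2 * N * n) (pow (2 * N))), (Module.finrank ℂ ↥(⨅ g ∈ M, LinearMap.eqLocus (act N N g) LinearMap.id)) = (Module.finrank ℚ ↥((B.hodge hN (2 * (N * n))).hodgeClasses ((N * n : ℕ) : ℤ))) ∧ (Module.finrank ℂ ↥(⨅ g ∈ G, LinearMap.eqLocus (act N N g) LinearMap.id)) = (Module.finrank ℚ ↥(B.W.algebraicClasses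 (pow (2 * N)) (N * n)))) ∧ (∀ N : ℕ, Literature.AlgebraicGeometry.Motives.IsSmoothProjective (2 * N * n) (pow (2 * N))) ∧ ((∀ N : ℕ, (Module.finrank ℂ ↥(⨅ g ∈ G, LinearMap.eqLocus (act N N g) LinearMap.id)) = (Module.finrank ℂ ↥(⨅ g ∈ M, LinearMap.eqLocus (act N N g) LinearMap.id))) → ∀ p : ℕ, B.HodgeConjectureFor hX p))))

/-- item stmt-HodgeConjecture-11039 · support · rank 9 · closed · proved by Summit.HodgeConjecture.HodgeConjecture.Theorems.momentAmplification_densityForcesEquality_proof @ 8faa685e1447 (prover) · by planner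
why it might fail: Elementary, yet false as typed if some X^{2N} had h_N = 0 in this indexing (pow 0 = 𝟙 needs the unit class non-zero and Hodge; D ≥ 1 needs deg η^D > 0) — both follow from C-lite axioms; watch the ∃hN/∀hN binders (proof-irrelevant).
sources: Kleiman1968, Biane1993TensorMultiplicities, LarsenPink1990
[support] THE MOMENT STEP, provable now from the C-lite axioms (no guard needed): for ANY B :
BettiHodgeData ℂ and X smooth projective of dimension n, with m_N := dim_ℚ ℚ·A^{nN}_B(X^{2N}) and
h_N := dim_ℚ Hdg^{nN}_B(X^{2N}) (X^{2N} := Nat.rec 𝟙 (· ⊗ X) (2N), witnesses hN as binders), IF the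
HALF-OR-ALL DICHOTOMY holds (m_N = h_N for all N, hN; or for every δ > 0 eventually in N, for all
hN, m_N ≤ (1/2+δ) h_N) AND the DENSITY property (∃ δ > 0, frequently in N, ∃ hN, (1/2+δ) h_N ≤ m_N),
THEN m_N = h_N for all N, hN. Proof: h_N ≥ 1 always (ℚ·A ≤ Hdg by
BettiHodgeData.algebraicClasses_le_hodgeClasses; for dimension D = 2Nn ≥ 1 a hyperplane class η of
X^{2N} exists (isHyperplaneClass_nonempty), is rational algebraic (pullback_ratAlgebraicClasses_le
from ℙ^N), η^{nN} ∈ ℚ·A (cup_mem_ratAlgebraicClasses) and η^{nN} ≠ 0 because tr(η^{2nN}) > 0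
(trace_pow_of_isHyperplaneClass, cup_assoc); D = 0: the unit = class of the generic point
(cycleClass_of_coheight_eq_zero) is non-zero by one_cup and finrank_obj_zero); 'frequently P ∧
eventually Q' yields N with (1/2+δ) h_N ≤ m_N ≤ (1/2+δ/2) h_N, i.e. h_N ≤ 0 — contradiction; hence
the first alternative. In `closes` the dichotomy comes from HalfOrAl -/
@[route_item "route-HodgeConjecture-MomentAmplification", crux]
def DensityForcesEquality : Prop :=
  ∀ B : Literature.AlgebraicGeometry.Motives.BettiHodgeData ℂ, ∀ ⦃n : ℕ⦄ ⦃X : Literature.AlgebraicGeometry.Motives.SchemeOver ℂ⦄, Literature.AlgebraicGeometry.Motives.IsSmoothProjective n X → (let pow := (fun k : ℕ => @Nat.rec (fun _ => Literature.AlgebraicGeometry.Motives.SchemeOver ℂ) (CategoryTheory.MonoidalCategoryStruct.tensorUnit (Literature.AlgebraicGeometry.Motives.SchemeOver ℂ)) (fun _ Y => CategoryTheory.MonoidalCategoryStruct.tensorObj Y X) k); (((∀ (N : ℕ) (hN : Literature.AlgebraicGeometry.Motives.IsSmoothProjective (2 * N * n) (pow (2 * N))), (Module.finrank ℚ ↥(B.W.algebraicClasses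 (pow (2 * N)) (N * n))) = (Module.finrank ℚ ↥((B.hodge hN (2 * (N * n))).hodgeClasses ((N * n : ℕ) : ℤ)))) ∨ (∀ δ : ℝ, 0 < δ → ∀ᶠ N in Filter.atTop, ∀ hN : Literature.AlgebraicGeometry.Motives.IsSmoothProjective (2 * N * n) (pow (2 * N)), ((Module.finrank ℚ ↥(B.W.algebraicClasses (pow (2 * N)) (N * n))) : ℝ) ≤ (1 / 2 + δ) * ((Module.finrank ℚ ↥((B.hodge hN (2 * (N * n))).hodgeClasses ((N * n : ℕ) : ℤ))) : ℝ))) → (∃ δ : ℝ, 0 < δ ∧ ∃ᶠ N in Filter.atTop, ∃ hN : Literature.AlgebraicGeometry.Motives.IsSmoothProjective (2 * N * n) (pow (2 * N)), (1 / 2 + δ) * ((Module.finrank ℚ ↥((B.hodge hN (2 * (N * n))).hodgeClasses ((N * n : ℕ) : ℤ))) : ℝ) ≤ ((Module.finrank ℚ ↥(B.W.algebraicClasses (pow (2 * N)) (N * n))) : ℝ)) → (∀ (N : ℕ) (hN : Literature.AlgebraicGeometry.Motives.IsSmoothProjective (2 * N * n) (pow (2 * N))), (Module.finrank ℚ ↥(B.W.algebraicClasses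 (pow (2 * N)) (N * n))) = (Module.finrank ℚ ↥((B.hodge hN (2 * (N * n))).hodgeClasses ((N * n : ℕ) : ℤ))))))

-- `DensityForcesEquality` holds: proved by `Summit.HodgeConjecture.HodgeConjecture.Theorems.momentAmplification_densityForcesEquality_proof` @ 8faa685e1447 (its module imports this route file, so no `_holds` link can be stated here).

-- earlier Assembly (stmt-HodgeConjecture-2805, replaced 2026-08-15T16:35:40Z -> stmt-HodgeConjecture-11034): retired by None — MotivatedDensity → HalfOrAll → LefschetzB → BettiBridge → HodgeConjecture
/-- item stmt-HodgeConjecture-11034 · assembly · rank 1 · closed · proved by Summit.HodgeConjecture.HodgeConjecture.Theorems.momentAmplification_assembly_proof @ f7270ba82e53 (prover) · by planner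
[assembly] AlgebraicDensity → LefschetzBetti → HalfOrAll → BettiCompat → TannakaBridge →
DensityForcesEquality → HodgeConjecture (thesis X = AlgebraicDensity ∧ LefschetzBetti; the other
four are support). It is literally the type of the deciding theorem `closes` (PROVED, rendered
below: B from BettiCompat; for each X TannakaBridge (fed LefschetzBetti) gives abstract M ≤ G with
counts, powers and rigidity; HalfOrAll on M ≤ G gives the dichotomy for (m_N, h_N) after rewriting
the two count identities; DensityForcesEquality with AlgebraicDensity gives m_N = h_N for all N;
rewriting back gives equal invariants, rigidity gives B.HodgeConjectureFor hX p for all p;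
IsComparisonCompatible.hodgeConjectureFor transports to HodgeTheory.HodgeConjectureFor), so `theorem
Assembly_proof : Assembly := closes` closes this item at once. -/
@[route_item "route-HodgeConjecture-MomentAmplification"]
def Assembly : Prop :=
  AlgebraicDensity → LefschetzBetti → HalfOrAll → BettiCompat → TannakaBridge → DensityForcesEquality → HodgeConjecture

-- `Assembly` holds: proved by `Summit.HodgeConjecture.HodgeConjecture.Theorems.momentAmplification_assembly_proof` @ f7270ba82e53 (its module imports this route file, so no `_holds` link can be stated here).

/-! D-0027 §2.1 — DECIDING THEOREM (planner-authored via `route open/edit --closes-file`; by planner-rrepair-HodgeConjecture-MomentAmplific-1838a883-g2-0 2026-08-15T16:35:40Z):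
its hypotheses are this route's items and its conclusion the sub-problem Statement (glue_lint), and it elaborates with this file. -/

@[closes "route-HodgeConjecture-MomentAmplification"] theorem closes : AlgebraicDensity → LefschetzBetti → HalfOrAll → BettiCompat → TannakaBridge → DensityForcesEquality → _root_.HodgeConjecture := by
  intro hD hL hH hC hT hE n X hX
  obtain ⟨B, hc⟩ := hC
  obtain ⟨d, M, G, hMG, hRED, hCONN, hFIX, hcnt, hpow, hrig⟩ := hT B hc (hL B hc) hX
  refine hc.hodgeConjectureFor hX (hrig fun N => ?_)
  have heq := hE B hX ?_ (hD B hc hX)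
  · rw [(hcnt N (hpow N)).1, (hcnt N (hpow N)).2]
    exact heq N (hpow N)
  · rcases hH d M G hMG hRED hCONN hFIX with h1 | h2
    · exact Or.inl fun N hN => ((hcnt N hN).2.symm.trans ((h1 N).trans (hcnt N hN).1))
    · refine Or.inr fun δ hδ => (h2 δ hδ).mono fun N hN' hN => ?_
      rw [(hcnt N hN).1, (hcnt N hN).2] at hN'
      exact hN'

end Summit.HodgeConjecture.HodgeConjecture.Theses.MomentAmplification
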